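import Summits.HodgeConjecture.HodgeConjecture.Theorems.VHCAbelianSchemesRoadLefschetzFibreWeilPlane
import Literature.AlgebraicGeometry.HodgeTheory.TimesGluedBlocksProductSpan
import HarnessLib

/-!
# Road b02 (`VHCAbelianSchemesRoad`, D-0059) — THE PINNED `(6,3)` RESIDUAL (stub 2b″ of skeleton v3.1 of crux `SemiregularSheafRepresentativesTwAtDiag`,
# stmt-HodgeConjecture-19787): THE 3-PARAMETER PRODUCT LOCUS `S₁ × S₂ × S₃` OF A `(3,d,δ)` WEIL COMPONENT IS A LOCUS OF LEFSCHETZ FIBRES —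
# UNCONDITIONALLY (no Hazama binder): `Y × S₂ × S₃` satisfies Moonen–Zarhin's condition (D) for every `Y` of dimension `1` or `2` and all simple
# abelian surfaces `S₂`, `S₃` not of CM type; the product of three QM surfaces is of Weil type `(3,d)` with a LEFSCHETZ Weil plane

research route conditional on HC_CM; not a corollary; Q11.4-sentence-2 already refuted in dim ≥ 3.

FACT-FREE; `HC_CM` nowhere; no `def`; sequel to `VHCAbelianSchemesRoadSecantQuotientResidualLefschetzFibre` (p535302: Lefschetz fibres `B = D` are
served fibres; supply = powers of abelian varieties of dimension `≤ 3`, headline the QM-cubes `S_δ³`) and `VHCAbelianSchemesRoadLefschetzFibreWeilPlane`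
(p537129: the Weil plane of a divisor-generated abelian variety of Weil type is Lefschetz; QM-powers are of Weil type). The stub
`stub_residual_63_secantQuotientPinned` (T3 PLAN-ONLY designate) is NOT restated, claimed or weakened (ring2-b03 gen 83 on director-hodge g8's PLATE
ORDER, HOME INBOX l.5115, item (b): «the served-fibre lemma for the 3-parameter product locus `S₁ × S₂ × S₃`», asked Hazama-conditional — delivered
UNCONDITIONAL: the tree's Moonen–Zarhin Lemma (3.4) rows for simple surfaces of types I(1), I(2), II(1) (`TimesGluedBlocksProductSpan` §5–§6) make
the named fact `Hazama1989_stablyNondegenerate_prod` unnecessary for QM surfaces).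

THE LOCUS (arithmetic AS PRINTED, untyped — family supply is not in the tree; evidence memos of gen 82∕83): on a `(3, d, δ)` component the hermitian
form is `⟨1,δ⟩^{⊥3}` (Landherr; kernel: `weilHermitian_congruent_qmCubeBlocks`, p538715), so besides the DIAGONAL Shimura curve of QM-cubes `S³`
(the prequels) the component contains the 3-PARAMETER locus of products `S₁ × S₂ × S₃` of three abelian surfaces with multiplication by the
indefinite quaternion algebra `B_δ = (−D, −δ)_ℚ ∋ K` — on a NON-SPLIT component a DIVISION algebra, so the generic `S_i` is SIMPLE of type II(1)
and NOT of CM type. This file puts `B = D` (indeed condition (D): `B = D` on all powers) at every point of that locus whose last two factors are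
generic, in the kernel, unconditionally — so all of them are Lefschetz fibres, served for «algebraic classes», and the Weil plane is Lefschetz there.

§1 THE SIXFOLD PRODUCT ROW `isStablyNondegenerate_prod_simpleSurface_prod_simpleSurface`: `(Y × S₂) × S₃` is stably non-degenerate for `0 < dim Y ≤ 2`,
`S₂`, `S₃` simple abelian surfaces not of CM type — NO `Hom` hypothesis (Poincaré case analysis over the tree rows: `S₂ ~ S₃` ⟹ `Y × S₃ × S₃`, a
mixed power of the (D) fourfold `Y × S₃`; `Y` simple `~ S₃` likewise; `Y ~ E₁ × E₂` or `Hom(Y, S₃) = 0` ⟹ Moonen–Zarhin Lemma (3.4) row with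
`A = Y × S₂`); isogeny closure; the Hodge conjecture for all powers of everything isogenous to such a product (Lefschetz `(1,1)`), unconditionally.
§2 SERVED FIBRES in the p535302 format: triple-product anchor ⟹ Lefschetz anchor; affine base and compact pencils; the cell on pencils through the
locus from Lefschetz-fibre carriers (`under_mono`); carrier antitonicity. §3 WEIL TYPE: `(S₁ × S₂ × S₃, φ₁ × φ₂ × φ₃)` is of Weil type `(3, d)` for
three surfaces with `(−d, eᵢ)_ℚ ↪ End⁰(Sᵢ)` (`IsWeilType.prod` twice over p537129's surface lemma), and whenever `S₂`, `S₃` are simple non-CM its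
Weil plane — for ANY Weil structure, and on everything `K`-isogenous — lies in `D³ ⊗ ℂ`, hence is algebraic.

What is NOT claimed: (b″), (a″), the rung, the crux, any carrier statement, any cell, VHC, `HC_AV`, HC; that the locus meets any given pencil of the
residual; condition (D) for `S₁ × S₂ × S₃` with TWO arbitrary surface factors (false in general: `E_{−1} × E_{−2} × E_{−3} × E_{−6}` times a
surface); anything about the CM strata of the locus beyond what the prequels' elliptic-power ∕ surface-power anchors already give.
References: [cite: MoonenZarhin1999LowDim, Thm. 0.1 (4), Thm. 0.2 (4), §2 (2.2), condition (D), §3 Thm. (3.2)(1), Lemma (3.4), (5.2), (5.4)]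
[cite: Gordon1999HodgeAVSurvey, Thm. 7.5, Def. 7.6, Rem. 7.6.1] [cite: vanGeemen1994HodgeAV, §2.4, §3.6, Thm. 4.3, 4.9–4.11, 5.2–5.5]
[cite: vanGeemenVerra2003QuaternionicPryms, Lemma 4.5] [cite: MumfordAV1970, §19 Thm. 1 and Cor. 2 (pp. 173–174)] [cite: Bloch1972Semiregularity, Remark (7.5)]
[cite: Andre1996Motifs, Lemme 6.3.3 (ii) (p. 33)] [cite: VoisinHodgeI2002, Thm. 6.25, Thm. 7.10 and Thm. 11.30].
-/

noncomputable section

open CategoryTheory CategoryTheory.Limits AlgebraicGeometry Topology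

-- the cell's namespace repeats the summit name (`Summit.HodgeConjecture.HodgeConjecture…`), as in every `Ring2*` file
set_option linter.dupNamespace false
namespace Summit.HodgeConjecture.HodgeConjecture.Ring2.SemiregularRepresentatives

open Literature.AlgebraicGeometry Literature.AlgebraicGeometry.Motives
open Literature.AlgebraicGeometry.Motives.AbelianVariety
open Literature.AlgebraicGeometry.HodgeTheory
open Literature.AlgebraicGeometry.Milne1999 (IsOfCMType)
open Literature.AlgebraicTopology.SingularHomology
open Literature.Barriers.HodgeConjecture (divisorClassesSpan)
open Summit.Ventures.HSemireg (ObjClass)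

variable {𝒪 : ObjClass} {n p : ℕ}

/-! ## §1 The sixfold product row: `Y × S₂ × S₃` satisfies condition (D) — unconditionally, with no `Hom` hypothesis -/

section SixfoldRow

variable {Y S₂ S₃ : AbelianVariety ℂ}

/-- `A × S ~ S × A` (through the biproduct). [cite: MumfordAV1970, §19 (p. 169)] -/
theorem isIsogenous_prod_comm (A S : AbelianVariety ℂ) : (A.prod S).IsIsogenous (S.prod A) :=
  (IsIsogenous.trans ⟨(biprodIsoProd A S).inv, isIsogeny_hom_of_iso (biprodIsoProd A S).symm⟩ (isIsogenous_biprod_comm A S)).trans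
    ⟨(biprodIsoProd S A).hom, isIsogeny_hom_of_iso (biprodIsoProd S A)⟩

/-- **`(A × S) × S` satisfies (D) as soon as `A × S` does** (it is the mixed power `A¹ × S²` of the (D) product, up to the isogenies
`(A × S) × S ~ (S × A) × S ~ A × (S × S)`; Gordon Rem. 7.6.1, the tree's `IsStablyNondegenerate.powSucc_prod_powSucc`).
[cite: Gordon1999HodgeAVSurvey, Rem. 7.6.1] [cite: vanGeemen1994HodgeAV, §3.6 (p. 236)] -/
theorem isStablyNondegenerate_prod_prod_self_of_prod {A S : AbelianVariety ℂ} (h : IsStablyNondegenerate (A.prod S)) :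
    IsStablyNondegenerate ((A.prod S).prod S) :=
  have h2 : IsStablyNondegenerate (A.prod (S.prod S)) := h.powSucc_prod_powSucc 0 1
  ((h2.of_isIsogenous (isIsogenous_prodRotate S A S)).of_isIsogenous' ((isIsogenous_prod_comm S A).prod (IsIsogenous.refl S)))

/-- **THE SIXFOLD PRODUCT ROW — `(Y × S₂) × S₃` SATISFIES CONDITION (D) for EVERY abelian variety `Y` of dimension `1` or `2` and all SIMPLE
abelian SURFACES `S₂`, `S₃` NOT of CM type (types I(1), I(2), II(1)), with NO `Hom` hypothesis** — in particular for the generic stratum of the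
3-parameter product locus of a non-split `(3, d, δ)` component (three `B_δ`-QM surfaces, pairwise isogenous or not, the first one arbitrary).
CASES (Poincaré): `Hom(S₂, S₃) ≠ 0` ⟹ `S₂ ~ S₃` and `(Y × S₂) × S₃ ~ (Y × S₃) × S₃`, (D) from the fourfold row `Y × S₃`
(`isStablyNondegenerate_prod_simpleSurface_of_dim_le_two`) by `isStablyNondegenerate_prod_prod_self_of_prod`; `Hom(S₂, S₃) = 0` and `Y` simple with
`Hom(Y, S₃) ≠ 0` ⟹ `Y ~ S₃`, `~ (S₂ × S₃) × S₃` likewise; `Y` simple with `Hom(Y, S₃) = 0`, or `Y ~ E₁ × E₂` (then `Hom(E₁ × E₂, S₃) = 0` by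
dimension) ⟹ `Hom(Y × S₂, S₃) = 0` and the Moonen–Zarhin Lemma (3.4) row `IsStablyNondegenerate.prod_simpleSurface_of_not_isOfCMType_of_forall_hom_eq_zero`
with `A = Y × S₂` (D). UNCONDITIONAL. [cite: MoonenZarhin1999LowDim, §2 (2.2), §3 Lemma (3.4), Thm. (3.2)(1) and (5.2), (5.4)]
[cite: MumfordAV1970, §19 Thm. 1 and Cor. 2 (pp. 173–174)] [cite: Gordon1999HodgeAVSurvey, Thm. 7.5, Def. 7.6 and Rem. 7.6.1] -/
theorem isStablyNondegenerate_prod_simpleSurface_prod_simpleSurface (h0 : 0 < Y.dim) (h2 : Y.dim ≤ 2) (hS₂s : S₂.IsSimple)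
    (hS₂ : S₂.dim = 2) (hcm₂ : ¬ IsOfCMType S₂) (hS₃s : S₃.IsSimple) (hS₃ : S₃.dim = 2) (hcm₃ : ¬ IsOfCMType S₃) :
    IsStablyNondegenerate ((Y.prod S₂).prod S₃) := by
  classical
  by_cases h23 : ∀ g : S₂ ⟶ S₃, g = 0
  swap
  · -- `S₂ ~ S₃`: `(Y × S₂) × S₃ ~ (Y × S₃) × S₃`, a mixed power of the (D) fourfold `Y × S₃`
    obtain ⟨g, hg⟩ := not_forall.1 h23
    have hiso : S₂.IsIsogenous S₃ := ⟨g, isIsogeny_of_isSimple_of_ne_zero hS₂s hS₃s g hg⟩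
    exact (isStablyNondegenerate_prod_prod_self_of_prod
      (isStablyNondegenerate_prod_simpleSurface_of_dim_le_two h0 h2 hS₃s hS₃ hcm₃)).of_isIsogenous
      (((IsIsogenous.refl Y).prod hiso).prod (IsIsogenous.refl S₃))
  · by_cases hYs : Y.IsSimple
    · by_cases hY3 : ∀ u : Y ⟶ S₃, u = 0
      · -- `Hom(Y × S₂, S₃) = 0`: the Lemma (3.4) row with `A = Y × S₂`
        exact (isStablyNondegenerate_prod_simpleSurface_of_dim_le_two h0 h2 hS₂s hS₂ hcm₂)
          |>.prod_simpleSurface_of_not_isOfCMType_of_forall_hom_eq_zero hS₃s hS₃ hcm₃ (prod_hom_eq_zero_of_forall hY3 h23)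
      · -- `Y ~ S₃`: `(Y × S₂) × S₃ ~ (S₃ × S₂) × S₃ ~ (S₂ × S₃) × S₃`
        obtain ⟨u, hu⟩ := not_forall.1 hY3
        have hiso : Y.IsIsogenous S₃ := ⟨u, isIsogeny_of_isSimple_of_ne_zero hYs hS₃s u hu⟩
        have hD : IsStablyNondegenerate ((S₂.prod S₃).prod S₃) :=
          isStablyNondegenerate_prod_prod_self_of_prod
            (isStablyNondegenerate_prod_simpleSurface_of_dim_le_two (Y := S₂) (by omega) (by omega) hS₃s hS₃ hcm₃)
        exact hD.of_isIsogenous ((((hiso.prod (IsIsogenous.refl S₂)).trans (isIsogenous_prod_comm S₃ S₂))).prod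
          (IsIsogenous.refl S₃))
    · -- `Y` not simple: `Y ~ E₁ × E₂`, `Hom(E₁ × E₂, S₃) = 0` by dimension, the Lemma (3.4) row with `A = (E₁ × E₂) × S₂`
      have hY2 : Y.dim = 2 := by
        by_contra hY2
        exact hYs (isSimple_of_dim_le_one (by omega))
      obtain ⟨E₁, E₂, h₁, h₂', hY⟩ := exists_curve_prod_curve_isIsogenous_of_not_isSimple_surface hY2 hYs
      have hHom : ∀ u : (E₁.prod E₂).prod S₂ ⟶ S₃, u = 0 :=
        prod_hom_eq_zero_of_forall (prod_hom_eq_zero_of_forall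
          (hom_eq_zero_of_isSimple_of_dim_ne (isSimple_of_dim_le_one h₁.le) hS₃s (by omega))
          (hom_eq_zero_of_isSimple_of_dim_ne (isSimple_of_dim_le_one h₂'.le) hS₃s (by omega))) h23
      have hD : IsStablyNondegenerate (((E₁.prod E₂).prod S₂).prod S₃) :=
        (isStablyNondegenerate_prod_simpleSurface_of_dim_le_two (Y := E₁.prod E₂) (by rw [dim_prod]; omega)
          (by rw [dim_prod]; omega) hS₂s hS₂ hcm₂).prod_simpleSurface_of_not_isOfCMType_of_forall_hom_eq_zero hS₃s hS₃ hcm₃ hHom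
      exact hD.of_isIsogenous' ((hY.prod (IsIsogenous.refl S₂)).prod (IsIsogenous.refl S₃))

/-- **THREE ABELIAN SURFACES: `S₁ × S₂ × S₃` satisfies (D) for every abelian surface `S₁` and all simple abelian surfaces `S₂`, `S₃` not of
CM type** — the generic stratum of the 3-parameter product locus of every non-split `(3,d,δ)` component and its boundary where the FIRST
factor degenerates arbitrarily (to a CM point `E_L²`, to `E′ × E″`, …). [cite: MoonenZarhin1999LowDim, §2 (2.2), Lemma (3.4) and (5.2)]
[cite: Gordon1999HodgeAVSurvey, Thm. 7.5 and Def. 7.6] -/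
theorem isStablyNondegenerate_surface_prod_simpleSurface_prod_simpleSurface {S₁ : AbelianVariety ℂ} (hS₁ : S₁.dim = 2)
    (hS₂s : S₂.IsSimple) (hS₂ : S₂.dim = 2) (hcm₂ : ¬ IsOfCMType S₂) (hS₃s : S₃.IsSimple) (hS₃ : S₃.dim = 2)
    (hcm₃ : ¬ IsOfCMType S₃) : IsStablyNondegenerate ((S₁.prod S₂).prod S₃) :=
  isStablyNondegenerate_prod_simpleSurface_prod_simpleSurface (by omega) (by omega) hS₂s hS₂ hcm₂ hS₃s hS₃ hcm₃

/-- **Everything isogenous to such a `Y × S₂ × S₃` is stably non-degenerate** (`B = D` is an isogeny invariant, van Geemen §3.6).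
[cite: vanGeemen1994HodgeAV, §3.6 (p. 236)] [cite: MoonenZarhin1999LowDim, Lemma (3.4)] -/
theorem isStablyNondegenerate_of_isIsogenous_prod_simpleSurface_prod_simpleSurface (h0 : 0 < Y.dim) (h2 : Y.dim ≤ 2)
    (hS₂s : S₂.IsSimple) (hS₂ : S₂.dim = 2) (hcm₂ : ¬ IsOfCMType S₂) (hS₃s : S₃.IsSimple) (hS₃ : S₃.dim = 2)
    (hcm₃ : ¬ IsOfCMType S₃) {X : AbelianVariety ℂ} (hX : X.IsIsogenous ((Y.prod S₂).prod S₃)) : IsStablyNondegenerate X :=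
  (isStablyNondegenerate_prod_simpleSurface_prod_simpleSurface h0 h2 hS₂s hS₂ hcm₂ hS₃s hS₃ hcm₃).of_isIsogenous hX

/-- **The Hodge conjecture for EVERY POWER of every abelian variety isogenous to `Y × S₂ × S₃`** (`0 < dim Y ≤ 2`; `S₂`, `S₃` simple non-CM
surfaces) — UNCONDITIONALLY (Lefschetz `(1,1)` and products: `B = D` on all powers). [cite: MoonenZarhin1999LowDim, §2 condition (D) and Lemma (3.4)]
[cite: vanGeemen1994HodgeAV, §2.4 and Lemma 3.7] -/
theorem hodgeConjectureFor_powSucc_of_isIsogenous_prod_simpleSurface_prod_simpleSurface (h0 : 0 < Y.dim) (h2 : Y.dim ≤ 2)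
    (hS₂s : S₂.IsSimple) (hS₂ : S₂.dim = 2) (hcm₂ : ¬ IsOfCMType S₂) (hS₃s : S₃.IsSimple) (hS₃ : S₃.dim = 2)
    (hcm₃ : ¬ IsOfCMType S₃) {X : AbelianVariety ℂ} (hX : X.IsIsogenous ((Y.prod S₂).prod S₃)) (N : ℕ) :
    HodgeConjectureFor (X.powSucc N).dim (X.powSucc N).X :=
  (isStablyNondegenerate_of_isIsogenous_prod_simpleSurface_prod_simpleSurface h0 h2 hS₂s hS₂ hcm₂ hS₃s hS₃ hcm₃ hX)
    |>.hodgeConjectureFor_powSucc N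

/-- **The Hodge conjecture for `Y × S₂ × S₃` itself** (the sixfolds `S₁ × S₂ × S₃` and the fivefolds `E × S₂ × S₃`).
[cite: MoonenZarhin1999LowDim, §2 condition (D), Lemma (3.4) and Thm. 0.2 (4)] [cite: vanGeemen1994HodgeAV, §2.4] -/
theorem hodgeConjectureFor_prod_simpleSurface_prod_simpleSurface (h0 : 0 < Y.dim) (h2 : Y.dim ≤ 2) (hS₂s : S₂.IsSimple)
    (hS₂ : S₂.dim = 2) (hcm₂ : ¬ IsOfCMType S₂) (hS₃s : S₃.IsSimple) (hS₃ : S₃.dim = 2) (hcm₃ : ¬ IsOfCMType S₃) :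
    HodgeConjectureFor ((Y.prod S₂).prod S₃).dim ((Y.prod S₂).prod S₃).X :=
  (isStablyNondegenerate_prod_simpleSurface_prod_simpleSurface h0 h2 hS₂s hS₂ hcm₂ hS₃s hS₃ hcm₃).hodgeConjectureFor

end SixfoldRow

/-! ## §2 The product locus is a locus of Lefschetz fibres: served fibres, the cell on pencils through it, carrier antitonicity -/

section ServedFibres

variable {𝒳 C : SchemeOver ℂ} {f : 𝒳 ⟶ C}

/-- **Anchor implication: a TRIPLE-PRODUCT fibre is a Lefschetz fibre** («`X ≅ A₀ ~ (Y × S₂) × S₃`, `dim A₀ = n`, `0 < dim Y ≤ 2`, `S₂`, `S₃`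
simple non-CM surfaces» ⟹ «`X ≅ A₀`, `B•(A₀) = D•(A₀)`»), by §1. [cite: MoonenZarhin1999LowDim, §2 condition (D) and Lemma (3.4)] -/
theorem lefschetzAnchor_of_surfaceTripleProductAnchor {X : SchemeOver ℂ}
    (h : ∃ (A₀ Y S₂ S₃ : AbelianVariety ℂ), A₀.dim = n ∧ 0 < Y.dim ∧ Y.dim ≤ 2 ∧ S₂.IsSimple ∧ S₂.dim = 2 ∧ ¬ IsOfCMType S₂ ∧
      S₃.IsSimple ∧ S₃.dim = 2 ∧ ¬ IsOfCMType S₃ ∧ A₀.IsIsogenous ((Y.prod S₂).prod S₃) ∧ Nonempty (A₀.X ≅ X)) :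
    ∃ A₀ : AbelianVariety ℂ, A₀.dim = n ∧ IsDivisorGenerated A₀ ∧ Nonempty (A₀.X ≅ X) := by
  obtain ⟨A₀, Y, S₂, S₃, hd, h0, h2, hS₂s, hS₂, hcm₂, hS₃s, hS₃, hcm₃, hiso, he⟩ := h
  exact ⟨A₀, hd, (isStablyNondegenerate_of_isIsogenous_prod_simpleSurface_prod_simpleSurface h0 h2 hS₂s hS₂ hcm₂ hS₃s
    hS₃ hcm₃ hiso).isDivisorGenerated, he⟩

/-- **A PENCIL WITH A TRIPLE-PRODUCT FIBRE IS SERVED THERE** (affine base, quasi-projective total space — the cell's shape) for the Lefschetz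
anchor data «`X ≅ A₀`, `B = D` on `A₀`, `θ` a polarisation class» ∕ «algebraic classes» (the prequel's `hasServedFibre_of_lefschetzFibre`; the
3-parameter product locus of a non-split Weil component). [cite: vanGeemen1994HodgeAV, §2.4 and 5.4] [cite: MoonenZarhin1999LowDim, Lemma (3.4)]
[cite: Bloch1972Semiregularity, Remark (7.5)] -/
theorem hasServedFibre_of_surfaceTripleProductFibre (hf : IsSmoothProjectiveFamily f n) (h𝒳 : IsQuasiProjectiveOver 𝒳) [IsAffine C.left]
    {t : ComplexPoints C} {A₀ Y S₂ S₃ : AbelianVariety ℂ} (hd : A₀.dim = n) (h0 : 0 < Y.dim) (h2 : Y.dim ≤ 2) (hS₂s : S₂.IsSimple)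
    (hS₂ : S₂.dim = 2) (hcm₂ : ¬ IsOfCMType S₂) (hS₃s : S₃.IsSimple) (hS₃ : S₃.dim = 2) (hcm₃ : ¬ IsOfCMType S₃)
    (hiso : A₀.IsIsogenous ((Y.prod S₂).prod S₃)) (e₀ : A₀.X ≅ fiberOver f t) (W : complexBetti 𝒳 (2 * p))
    (hW : ∀ s : ComplexPoints C, IsRationalClass (complexBetti.map (fiberι f s) (2 * p) W) ∧
      IsOfHodgeType n (fiberOver f s) (2 * p) p p (complexBetti.map (fiberι f s) (2 * p) W)) :
    HasServedFibre n p
      (fun X θ ↦ (∃ A₀ : AbelianVariety ℂ, A₀.dim = n ∧ IsDivisorGenerated A₀ ∧ Nonempty (A₀.X ≅ X)) ∧ IsPolarizationClass n X θ)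
      (fun X _ ↦ (algebraicClasses X p : Set (complexBetti X (2 * p)))) f W :=
  hasServedFibre_of_lefschetzFibre hf h𝒳 hd (isStablyNondegenerate_of_isIsogenous_prod_simpleSurface_prod_simpleSurface h0 h2
    hS₂s hS₂ hcm₂ hS₃s hS₃ hcm₃ hiso).isDivisorGenerated e₀ W hW

/-- **The COMPACT twin: a compact pencil of abelian varieties with a triple-product fibre is served there** (the shape of the André column's
pencils). [cite: Andre1996Motifs, Lemme 6.3.3 (ii) (p. 33)] [cite: vanGeemen1994HodgeAV, §2.4] [cite: MoonenZarhin1999LowDim, Lemma (3.4)] -/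
theorem hasServedFibre_compactPencil_of_surfaceTripleProductFibre (hf : IsCompactAbelianPencil f n) {s₀ : ComplexPoints C}
    {A₀ Y S₂ S₃ : AbelianVariety ℂ} (h0 : 0 < Y.dim) (h2 : Y.dim ≤ 2) (hS₂s : S₂.IsSimple) (hS₂ : S₂.dim = 2) (hcm₂ : ¬ IsOfCMType S₂)
    (hS₃s : S₃.IsSimple) (hS₃ : S₃.dim = 2) (hcm₃ : ¬ IsOfCMType S₃) (hiso : A₀.IsIsogenous ((Y.prod S₂).prod S₃))
    (e₀ : A₀.X ≅ fiberOver f s₀) (W : complexBetti 𝒳 (2 * p))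
    (hW : ∀ s : ComplexPoints C, IsRationalClass (complexBetti.map (fiberι f s) (2 * p) W) ∧
      IsOfHodgeType n (fiberOver f s) (2 * p) p p (complexBetti.map (fiberι f s) (2 * p) W)) :
    HasServedFibre n p
      (fun X θ ↦ (∃ A₀ : AbelianVariety ℂ, A₀.dim = n ∧ IsDivisorGenerated A₀ ∧ Nonempty (A₀.X ≅ X)) ∧ IsPolarizationClass n X θ)
      (fun X _ ↦ (algebraicClasses X p : Set (complexBetti X (2 * p)))) f W :=
  hasServedFibre_compactPencil_of_lefschetzFibre hf (isStablyNondegenerate_of_isIsogenous_prod_simpleSurface_prod_simpleSurface h0 h2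
    hS₂s hS₂ hcm₂ hS₃s hS₃ hcm₃ hiso).isDivisorGenerated e₀ W hW

/-- **LEFSCHETZ-FIBRE CARRIERS GIVE EVERY CELL ON THE PENCILS THROUGH THE PRODUCT LOCUS** (door-, degree-generic): `AnchoredCarrierAt 𝒪 n p` at
«Lefschetz anchors» ∕ «algebraic classes» ⟹ the cell `(n, p)` under «some fibre is isomorphic to an abelian `n`-fold isogenous to a
`Y × S₂ × S₃`» (the prequel's `under_lefschetzFibre_of_lefschetzCarrierAt`, and the conditional cell is antitone in its hypothesis).
[cite: Bloch1972Semiregularity, Remark (7.5)] [cite: MoonenZarhin1999LowDim, Lemma (3.4)] [cite: vanGeemen1994HodgeAV, Thm. 4.11] -/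
theorem under_surfaceTripleProductFibre_of_lefschetzCarrierAt
    (hA : AnchoredCarrierAt 𝒪 n p
      (fun X θ ↦ (∃ A₀ : AbelianVariety ℂ, A₀.dim = n ∧ IsDivisorGenerated A₀ ∧ Nonempty (A₀.X ≅ X)) ∧ IsPolarizationClass n X θ)
      (fun X _ ↦ (algebraicClasses X p : Set (complexBetti X (2 * p))))) :
    LefAtExceptionalRegimeAtUnder 𝒪 n p (fun _ C f _ ↦ ∃ (t : ComplexPoints C) (A₀ Y S₂ S₃ : AbelianVariety ℂ),
      A₀.dim = n ∧ 0 < Y.dim ∧ Y.dim ≤ 2 ∧ S₂.IsSimple ∧ S₂.dim = 2 ∧ ¬ IsOfCMType S₂ ∧ S₃.IsSimple ∧ S₃.dim = 2 ∧ ¬ IsOfCMType S₃ ∧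
      A₀.IsIsogenous ((Y.prod S₂).prod S₃) ∧ Nonempty (A₀.X ≅ fiberOver f t)) :=
  under_mono (fun _ _ _ _ ⟨t, A₀, Y, S₂, S₃, hd, h0, h2, hS₂s, hS₂, hcm₂, hS₃s, hS₃, hcm₃, hiso, he⟩ ↦ by
      obtain ⟨A₁, hd₁, hD₁, he₁⟩ := lefschetzAnchor_of_surfaceTripleProductAnchor (n := n)
        ⟨A₀, Y, S₂, S₃, hd, h0, h2, hS₂s, hS₂, hcm₂, hS₃s, hS₃, hcm₃, hiso, he⟩
      exact ⟨t, A₁, hd₁, hD₁, he₁⟩)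
    (under_lefschetzFibre_of_lefschetzCarrierAt hA)

/-- **The Lefschetz-fibre carrier statement CONTAINS the triple-product carrier statement** (the anchored carrier statement is antitone in the
anchor predicate): the per-variety find-the-sheaf problem on polarised sixfolds isogenous to `S₁ × S₂ × S₃` is an instance of the Lefschetz-fibre
one, exactly like the QM-cubes `S_δ³`. [cite: Bloch1972Semiregularity, Remark (7.5)] [cite: MoonenZarhin1999LowDim, Lemma (3.4)] -/
theorem surfaceTripleProductCarrierAt_of_lefschetzCarrierAt
    (hA : AnchoredCarrierAt 𝒪 n p
      (fun X θ ↦ (∃ A₀ : AbelianVariety ℂ, A₀.dim = n ∧ IsDivisorGenerated A₀ ∧ Nonempty (A₀.X ≅ X)) ∧ IsPolarizationClass n X θ)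
      (fun X _ ↦ (algebraicClasses X p : Set (complexBetti X (2 * p))))) :
    AnchoredCarrierAt 𝒪 n p
      (fun X θ ↦ (∃ (A₀ Y S₂ S₃ : AbelianVariety ℂ), A₀.dim = n ∧ 0 < Y.dim ∧ Y.dim ≤ 2 ∧ S₂.IsSimple ∧ S₂.dim = 2 ∧ ¬ IsOfCMType S₂ ∧
        S₃.IsSimple ∧ S₃.dim = 2 ∧ ¬ IsOfCMType S₃ ∧ A₀.IsIsogenous ((Y.prod S₂).prod S₃) ∧ Nonempty (A₀.X ≅ X)) ∧
        IsPolarizationClass n X θ)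
      (fun X _ ↦ (algebraicClasses X p : Set (complexBetti X (2 * p)))) :=
  anchoredCarrierAt_anti (fun _ _ h ↦ ⟨lefschetzAnchor_of_surfaceTripleProductAnchor h.1, h.2⟩) (fun _ _ _ ↦ subset_rfl) hA

end ServedFibres

/-! ## §3 The product of three QM surfaces is of Weil type `(3, d)`; its Weil plane is Lefschetz, hence algebraic -/

section WeilType

variable {S₁ S₂ S₃ X : AbelianVariety ℂ} {d : ℕ}

/-- **`(S₁ × S₂ × S₃, φ₁ × φ₂ × φ₃)` IS OF WEIL TYPE `(3, d)` for three abelian SURFACES with `(−d, eᵢ)_ℚ ↪ End⁰(Sᵢ)`** (`φᵢ² = −d`,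
`ψᵢ² = +eᵢ`, `φᵢψᵢ = −ψᵢφᵢ`: each factor is of Weil type `(1, d)` for `K = ℚ(φᵢ) ≅ ℚ(√−d)` by van Geemen–Verra Lemma 4.5 — the prequel's
`isWeilType_surface_of_anticomm_of_sq_eq_nsmul` —, multiplicities add, Moonen–Zarhin (1.9), the tree's `IsWeilType.prod`): the 3-parameter product
locus of QM surfaces with the same quaternion algebra `(−d, e)_ℚ ∋ K` lies in the Weil-type locus `(3, d)` for `K`.
[cite: vanGeemenVerra2003QuaternionicPryms, Lemma 4.5] [cite: MoonenZarhin1999LowDim, (1.9)] [cite: vanGeemen1994HodgeAV, 4.9 and 5.4] -/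
theorem isWeilType_prod_prod_of_anticomm_of_sq_eq_nsmul {e₁ e₂ e₃ : ℕ} {φ₁ ψ₁ : S₁ ⟶ S₁} {φ₂ ψ₂ : S₂ ⟶ S₂} {φ₃ ψ₃ : S₃ ⟶ S₃}
    (hd : 0 < d) (he₁ : 0 < e₁) (he₂ : 0 < e₂) (he₃ : 0 < e₃) (hS₁ : S₁.dim = 2) (hS₂ : S₂.dim = 2) (hS₃ : S₃.dim = 2)
    (hφ₁ : φ₁ ≫ φ₁ = -(d • 𝟙 S₁)) (hψ₁ : ψ₁ ≫ ψ₁ = e₁ • 𝟙 S₁) (h₁ : φ₁ ≫ ψ₁ = -(ψ₁ ≫ φ₁))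
    (hφ₂ : φ₂ ≫ φ₂ = -(d • 𝟙 S₂)) (hψ₂ : ψ₂ ≫ ψ₂ = e₂ • 𝟙 S₂) (h₂ : φ₂ ≫ ψ₂ = -(ψ₂ ≫ φ₂))
    (hφ₃ : φ₃ ≫ φ₃ = -(d • 𝟙 S₃)) (hψ₃ : ψ₃ ≫ ψ₃ = e₃ • 𝟙 S₃) (h₃ : φ₃ ≫ ψ₃ = -(ψ₃ ≫ φ₃)) :
    IsWeilType ((S₁.prod S₂).prod S₃)
      (prodLift (fst _ _ ≫ prodLift (fst _ _ ≫ φ₁) (snd _ _ ≫ φ₂)) (snd _ _ ≫ φ₃)) 3 d :=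
  ((isWeilType_surface_of_anticomm_of_sq_eq_nsmul hd he₁ hS₁ hφ₁ hψ₁ h₁).prod
    (isWeilType_surface_of_anticomm_of_sq_eq_nsmul hd he₂ hS₂ hφ₂ hψ₂ h₂)).prod
    (isWeilType_surface_of_anticomm_of_sq_eq_nsmul hd he₃ hS₃ hφ₃ hψ₃ h₃)

/-- **EVERY WEIL STRUCTURE ON `Y × S₂ × S₃` (`0 < dim Y ≤ 2`; `S₂`, `S₃` simple non-CM surfaces) HAS A LEFSCHETZ WEIL PLANE**: `weilClassesOf ⊆ Dᵐ ⊗ ℂ`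
(`B = D` there by §1; the plane is spanned by rational `(m,m)` classes — p537129's `weilClassesOf_le_divisorClassesSpan_of_isWeilType_of_isDivisorGenerated`).
UNCONDITIONAL. [cite: vanGeemen1994HodgeAV, 4.10 and §2.4] [cite: MoonenZarhin1999LowDim, §2 condition (D) and Lemma (3.4)] -/
theorem weilClassesOf_prod_simpleSurface_prod_simpleSurface_le_divisorClassesSpan {Y : AbelianVariety ℂ} (h0 : 0 < Y.dim) (h2 : Y.dim ≤ 2)
    (hS₂s : S₂.IsSimple) (hS₂ : S₂.dim = 2) (hcm₂ : ¬ IsOfCMType S₂) (hS₃s : S₃.IsSimple) (hS₃ : S₃.dim = 2) (hcm₃ : ¬ IsOfCMType S₃)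
    {Φ : (Y.prod S₂).prod S₃ ⟶ (Y.prod S₂).prod S₃} {m : ℕ} (hW : IsWeilType ((Y.prod S₂).prod S₃) Φ m d) :
    weilClassesOf ((Y.prod S₂).prod S₃) Φ m d ≤ divisorClassesSpan ((Y.prod S₂).prod S₃).X ((Y.prod S₂).prod S₃).dim m :=
  weilClassesOf_le_divisorClassesSpan_of_isWeilType_of_isDivisorGenerated hW
    (isStablyNondegenerate_prod_simpleSurface_prod_simpleSurface h0 h2 hS₂s hS₂ hcm₂ hS₃s hS₃ hcm₃).isDivisorGenerated

/-- **… hence ALGEBRAIC**: the Weil classes of every Weil structure on `Y × S₂ × S₃` are algebraic — the Hodge conjecture for the Weil plane ON THE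
3-PARAMETER PRODUCT LOCUS of every `(3,d,δ)` component (generic last two factors), in the kernel, unconditionally (trivially: they are Lefschetz
there). [cite: vanGeemen1994HodgeAV, §2.4, 4.10 and 5.4] [cite: MoonenZarhin1999LowDim, Lemma (3.4)] [cite: VoisinHodgeI2002, Thm. 11.30] -/
theorem weilClassesOf_prod_simpleSurface_prod_simpleSurface_le_algebraicClasses {Y : AbelianVariety ℂ} (h0 : 0 < Y.dim) (h2 : Y.dim ≤ 2)
    (hS₂s : S₂.IsSimple) (hS₂ : S₂.dim = 2) (hcm₂ : ¬ IsOfCMType S₂) (hS₃s : S₃.IsSimple) (hS₃ : S₃.dim = 2) (hcm₃ : ¬ IsOfCMType S₃)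
    {Φ : (Y.prod S₂).prod S₃ ⟶ (Y.prod S₂).prod S₃} {m : ℕ} (hW : IsWeilType ((Y.prod S₂).prod S₃) Φ m d) :
    weilClassesOf ((Y.prod S₂).prod S₃) Φ m d ≤ algebraicClasses ((Y.prod S₂).prod S₃).X m :=
  weilClassesOf_le_algebraicClasses_of_isWeilType_of_isDivisorGenerated hW
    (isStablyNondegenerate_prod_simpleSurface_prod_simpleSurface h0 h2 hS₂s hS₂ hcm₂ hS₃s hS₃ hcm₃).isDivisorGenerated

/-- **THE QM-TRIPLES: Weil type `(3, d)` WITH A LEFSCHETZ WEIL PLANE** — three surfaces with `(−d, eᵢ)_ℚ ↪ End⁰(Sᵢ)`, the last two simple and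
not of CM type (on a non-split component: generic members of the Shimura curve of `B_δ`-QM surfaces): the Weil plane of the sixfold
`(S₁ × S₂ × S₃, K)` consists of polynomials in divisor classes. [cite: vanGeemenVerra2003QuaternionicPryms, Lemma 4.5]
[cite: MoonenZarhin1999LowDim, (1.9), §2 (2.2) and Lemma (3.4)] [cite: vanGeemen1994HodgeAV, 4.9, 4.10 and 5.4] -/
theorem weilClassesOf_qmTriple_le_divisorClassesSpan {e₁ e₂ e₃ : ℕ} {φ₁ ψ₁ : S₁ ⟶ S₁} {φ₂ ψ₂ : S₂ ⟶ S₂} {φ₃ ψ₃ : S₃ ⟶ S₃}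
    (hd : 0 < d) (he₁ : 0 < e₁) (he₂ : 0 < e₂) (he₃ : 0 < e₃) (hS₁ : S₁.dim = 2) (hS₂ : S₂.dim = 2) (hS₃ : S₃.dim = 2)
    (hφ₁ : φ₁ ≫ φ₁ = -(d • 𝟙 S₁)) (hψ₁ : ψ₁ ≫ ψ₁ = e₁ • 𝟙 S₁) (h₁ : φ₁ ≫ ψ₁ = -(ψ₁ ≫ φ₁))
    (hφ₂ : φ₂ ≫ φ₂ = -(d • 𝟙 S₂)) (hψ₂ : ψ₂ ≫ ψ₂ = e₂ • 𝟙 S₂) (h₂ : φ₂ ≫ ψ₂ = -(ψ₂ ≫ φ₂))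
    (hφ₃ : φ₃ ≫ φ₃ = -(d • 𝟙 S₃)) (hψ₃ : ψ₃ ≫ ψ₃ = e₃ • 𝟙 S₃) (h₃ : φ₃ ≫ ψ₃ = -(ψ₃ ≫ φ₃))
    (hS₂s : S₂.IsSimple) (hcm₂ : ¬ IsOfCMType S₂) (hS₃s : S₃.IsSimple) (hcm₃ : ¬ IsOfCMType S₃) :
    IsWeilType ((S₁.prod S₂).prod S₃) (prodLift (fst _ _ ≫ prodLift (fst _ _ ≫ φ₁) (snd _ _ ≫ φ₂)) (snd _ _ ≫ φ₃)) 3 d ∧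
      weilClassesOf ((S₁.prod S₂).prod S₃) (prodLift (fst _ _ ≫ prodLift (fst _ _ ≫ φ₁) (snd _ _ ≫ φ₂)) (snd _ _ ≫ φ₃)) 3 d ≤
        divisorClassesSpan ((S₁.prod S₂).prod S₃).X ((S₁.prod S₂).prod S₃).dim 3 :=
  have hW := isWeilType_prod_prod_of_anticomm_of_sq_eq_nsmul hd he₁ he₂ he₃ hS₁ hS₂ hS₃ hφ₁ hψ₁ h₁ hφ₂ hψ₂ h₂ hφ₃ hψ₃ h₃
  ⟨hW, weilClassesOf_prod_simpleSurface_prod_simpleSurface_le_divisorClassesSpan (by omega) (by omega) hS₂s hS₂ hcm₂ hS₃s hS₃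
    hcm₃ hW⟩

/-- **… hence the Weil classes of the QM-triples are ALGEBRAIC.** [cite: vanGeemenVerra2003QuaternionicPryms, Lemma 4.5]
[cite: vanGeemen1994HodgeAV, §2.4, 4.10 and 5.4] [cite: MoonenZarhin1999LowDim, Lemma (3.4)] -/
theorem weilClassesOf_qmTriple_le_algebraicClasses {e₁ e₂ e₃ : ℕ} {φ₁ ψ₁ : S₁ ⟶ S₁} {φ₂ ψ₂ : S₂ ⟶ S₂} {φ₃ ψ₃ : S₃ ⟶ S₃}
    (hd : 0 < d) (he₁ : 0 < e₁) (he₂ : 0 < e₂) (he₃ : 0 < e₃) (hS₁ : S₁.dim = 2) (hS₂ : S₂.dim = 2) (hS₃ : S₃.dim = 2)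
    (hφ₁ : φ₁ ≫ φ₁ = -(d • 𝟙 S₁)) (hψ₁ : ψ₁ ≫ ψ₁ = e₁ • 𝟙 S₁) (h₁ : φ₁ ≫ ψ₁ = -(ψ₁ ≫ φ₁))
    (hφ₂ : φ₂ ≫ φ₂ = -(d • 𝟙 S₂)) (hψ₂ : ψ₂ ≫ ψ₂ = e₂ • 𝟙 S₂) (h₂ : φ₂ ≫ ψ₂ = -(ψ₂ ≫ φ₂))
    (hφ₃ : φ₃ ≫ φ₃ = -(d • 𝟙 S₃)) (hψ₃ : ψ₃ ≫ ψ₃ = e₃ • 𝟙 S₃) (h₃ : φ₃ ≫ ψ₃ = -(ψ₃ ≫ φ₃))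
    (hS₂s : S₂.IsSimple) (hcm₂ : ¬ IsOfCMType S₂) (hS₃s : S₃.IsSimple) (hcm₃ : ¬ IsOfCMType S₃) :
    weilClassesOf ((S₁.prod S₂).prod S₃) (prodLift (fst _ _ ≫ prodLift (fst _ _ ≫ φ₁) (snd _ _ ≫ φ₂)) (snd _ _ ≫ φ₃)) 3 d ≤
      algebraicClasses ((S₁.prod S₂).prod S₃).X 3 :=
  weilClassesOf_prod_simpleSurface_prod_simpleSurface_le_algebraicClasses (by omega) (by omega) hS₂s hS₂ hcm₂ hS₃s hS₃ hcm₃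
    (isWeilType_prod_prod_of_anticomm_of_sq_eq_nsmul hd he₁ he₂ he₃ hS₁ hS₂ hS₃ hφ₁ hψ₁ h₁ hφ₂ hψ₂ h₂ hφ₃ hψ₃ h₃)

/-- **`K`-ISOGENY INVARIANCE: everything `K`-isogenous to a Weil-type `Y × S₂ × S₃` has a Lefschetz Weil plane** — `g : X ⟶ (Y × S₂) × S₃` an
isogeny with `g ≫ Φ = χ ≫ g`, `χ² = −d`, `((Y × S₂) × S₃, Φ)` of Weil type `(m, d)` ⟹ `(X, χ)` is of Weil type `(m, d)` (the tree's
`IsWeilType.of_isIsogeny'`) and `weilClassesOf X χ m d ⊆ Dᵐ(X) ⊗ ℂ` — the form in which the anchor «`X ≅ A₀`, `A₀ ~ S₁ × S₂ × S₃`» meets the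
Weil structure of a pencil member. [cite: vanGeemen1994HodgeAV, 4.14 and §3.6] [cite: MoonenZarhin1999LowDim, (1.9) and Lemma (3.4)] -/
theorem weilClassesOf_le_divisorClassesSpan_of_isIsogeny_prod_simpleSurface_prod_simpleSurface {Y : AbelianVariety ℂ} (h0 : 0 < Y.dim)
    (h2 : Y.dim ≤ 2) (hS₂s : S₂.IsSimple) (hS₂ : S₂.dim = 2) (hcm₂ : ¬ IsOfCMType S₂) (hS₃s : S₃.IsSimple) (hS₃ : S₃.dim = 2)
    (hcm₃ : ¬ IsOfCMType S₃) {Φ : (Y.prod S₂).prod S₃ ⟶ (Y.prod S₂).prod S₃} {χ : X ⟶ X} {m : ℕ} (g : X ⟶ (Y.prod S₂).prod S₃)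
    (hg : AbelianVariety.IsIsogeny g) (hcomm : g ≫ Φ = χ ≫ g) (hχ : χ ≫ χ = -(d • 𝟙 X))
    (hW : IsWeilType ((Y.prod S₂).prod S₃) Φ m d) :
    IsWeilType X χ m d ∧ weilClassesOf X χ m d ≤ divisorClassesSpan X.X X.dim m :=
  have hX : IsWeilType X χ m d := hW.of_isIsogeny' g hg hcomm hχ
  ⟨hX, weilClassesOf_le_divisorClassesSpan_of_isWeilType_of_isDivisorGenerated hX
    (isStablyNondegenerate_of_isIsogenous_prod_simpleSurface_prod_simpleSurface h0 h2 hS₂s hS₂ hcm₂ hS₃s hS₃ hcm₃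
      ⟨g, hg⟩).isDivisorGenerated⟩

/-- **… hence algebraic.** [cite: vanGeemen1994HodgeAV, §2.4, 4.10 and 4.14] [cite: MoonenZarhin1999LowDim, Lemma (3.4)] -/
theorem weilClassesOf_le_algebraicClasses_of_isIsogeny_prod_simpleSurface_prod_simpleSurface {Y : AbelianVariety ℂ} (h0 : 0 < Y.dim)
    (h2 : Y.dim ≤ 2) (hS₂s : S₂.IsSimple) (hS₂ : S₂.dim = 2) (hcm₂ : ¬ IsOfCMType S₂) (hS₃s : S₃.IsSimple) (hS₃ : S₃.dim = 2)
    (hcm₃ : ¬ IsOfCMType S₃) {Φ : (Y.prod S₂).prod S₃ ⟶ (Y.prod S₂).prod S₃} {χ : X ⟶ X} {m : ℕ} (g : X ⟶ (Y.prod S₂).prod S₃)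
    (hg : AbelianVariety.IsIsogeny g) (hcomm : g ≫ Φ = χ ≫ g) (hχ : χ ≫ χ = -(d • 𝟙 X))
    (hW : IsWeilType ((Y.prod S₂).prod S₃) Φ m d) : weilClassesOf X χ m d ≤ algebraicClasses X.X m :=
  (weilClassesOf_le_divisorClassesSpan_of_isIsogeny_prod_simpleSurface_prod_simpleSurface h0 h2 hS₂s hS₂ hcm₂ hS₃s hS₃ hcm₃ g hg
    hcomm hχ hW).2.trans (divisorClassesSpan_le_algebraicClasses_of_isSmoothProjective (AbelianVariety.isSmoothProjective_holds (A := X)) m)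

end WeilType

end Summit.HodgeConjecture.HodgeConjecture.Ring2.SemiregularRepresentatives

end
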